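import Literature.AnabelianGeometry.AbsoluteAnabelian.AbsTopICuspInertiaOfPSC
import Literature.AnabelianGeometry.SemiGraphs.DoubleCosetFibres
import HarnessLib

/-!
# [AbsTopI] Lemma 4.5 SUB-DAG, row B3 at `ofPSC`: the cyclic cusp-count criterion, PROVED

abc-iut cell, layer L4, sub-DAG `plan/L4/SUBDAG-AbsTopI-Lem45.md` (holder abc-iut-w5-d062), row B3
`FundamentalExtension.CuspInertiaData.TotRamIffCount` (`AbsTopICuspidalDecompositionSub.lean`):
for a closed `I ≅ ℤ_l` (`AbsTopII.IsFreeProSigmaCyclic {l}`) and a characteristic open `J ⊆ H_*` with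
`J ≠ I·J`, "the cyclic covering determined by `J ⊆ I·J` is totally ramified at some cusp iff
`r(I^l·J) < l · r(I·J)`" — the AMENDED third sentence of [AbsTopI] Lemma 4.5 (iv) (S. Mochizuki,
*Topics in Absolute Anabelian Geometry I*, p. 54, lit key `paper:url-11ac98ba15fc`; amendment
[IUTchI] Remark 1.2.2 (i)(ii) p. 40 / Remark 1.2.3 (iii) p. 41: "if … the covering `G′ → G` is
cyclic, then `G′ → G` is cuspidally totally ramified if and only if the inequality `r(G″) < l · r(G)`
— where we write `G′ → G″ → G` for the unique [up to isomorphism] factorization … such that `G″ → G`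
is of degree `l` — is satisfied").

This PROOF-ONLY file proves B3 for the cusp-inertia data `CuspInertiaData.ofPSC G` of ANY pro-`{l}`
PSC datum `G : SemiGraphs.PSCDatum H_*` on a profinite (compact) `H_*` (abc-iut-w5-d062's bridge,
`AbsTopICuspInertiaOfPSC.lean`): `CuspInertiaData.totRamIffCount_ofPSC`.  NO covering datum for
`V = I·J` is constructed: layer L3 (abc-iut-L3) already PROVED the RELATIVE cyclic criterion
`SemiGraphs.PSCDatum.isCuspidallyTotallyRamified_iff_cuspCount_lt` ([IUTchI] Rmk 1.2.3 (iii) for a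
cyclic covering `G_U → G_B` of a covering `G_B`, `B` of finite index, `B/U` cyclic of order `l^k`) by
double-coset counting inside `Π_G = H_*` (`DoubleCosetFibres.lean`).  The remaining group theory, all
here: (a) "totally ramified at some cusp" of the sub-DAG = L3's `IsCuspidallyTotallyRamified (I ⊔ J) J`
(bridge pattern, no cusp-existence hypothesis needed once `J ≠ I·J`); (b) `J ⊆ I·J` is a cyclic
covering, generated by a dense generator `a` of `I` (`J ⊔ ⟨a⟩` is open, hence closed, hence `⊇ I`);
(c) `[I·J : J] = l^k` with `k ≥ 1` (pro-`{l}`: `[H_* : J]` is a power of `l`; `J ≠ I·J`); (d) the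
UNIQUE intermediate subgroup of index `l` of the cyclic layer (abc-iut-L3's Frattini subgroup,
`PSCCounting.exists_frattini_of_cyclic_quotient`) IS `⟨x^l : x ∈ I⟩ ⊔ J = I^l·J`, so L3's
"for every `M` of index `l`" collapses to the single printed inequality `r(I^l·J) < l · r(I·J)`.

HONEST FRAMING: refereed, undisputed pre-IUT anabelian group theory ([AbsTopI], [CombGC], and the
[IUTchI] Rmk 1.2.2/1.2.3 errata of the author); a kernel theorem about every PSC datum; nothing here
bears on [IUTchIII] Cor 3.12; typed ≠ proved elsewhere.
-/

noncomputable section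

open scoped Pointwise

namespace Literature.AnabelianGeometry.AbsoluteAnabelian.FundamentalExtension

open Literature.AnabelianGeometry.SemiGraphs

universe u

variable {Hstar : Type u} [Group Hstar] [TopologicalSpace Hstar]

section Helpers

omit [TopologicalSpace Hstar] in
/-- `y ^ [B : M] ∈ M` for `y ∈ B` when `M ∩ B` is normal in `B` (Lagrange in `B/(M ∩ B)`). [folklore] -/
private theorem pow_relIndex_mem {B M : Subgroup Hstar}
    (hN : (M.subgroupOf B).Normal) {y : Hstar} (hy : y ∈ B) : y ^ M.relIndex B ∈ M := by
  have h := Subgroup.pow_index_mem (M.subgroupOf B) ⟨y, hy⟩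
  rw [Subgroup.mem_subgroupOf, SubgroupClass.coe_pow] at h
  exact h

omit [TopologicalSpace Hstar] in
/-- A subgroup between `U ⊴ Π` and `B = U ⊔ ⟨g⟩` is normal in `B` (`B/U` is abelian).
[cite: MochizukiCombGC2007, Def 1.1(ii) p.7] -/
private theorem normal_subgroupOf_of_cyclic {U B M : Subgroup Hstar} [U.Normal] {g : Hstar}
    (hgen : U ⊔ Subgroup.zpowers g = B) (hUM : U ≤ M) (hMB : M ≤ B) : (M.subgroupOf B).Normal :=
  (Subgroup.normal_subgroupOf_iff_le_normalizer hMB).mpr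
    (PSCCounting.le_normalizer_of_commutator_le
      ((PSCCounting.commutator_le_of_sup_zpowers_eq U B hgen).trans hUM) hMB)

variable [IsTopologicalGroup Hstar]

/-- A closed subgroup `I` with a DENSE cyclic subgroup `⟨g⟩` lies in `J ⊔ ⟨g⟩` for every open
subgroup `J` (`J ⊔ ⟨g⟩` is open, hence closed, and contains the dense `⟨g⟩ ⊆ I`).
[cite: MochizukiCombGC2007, Def 1.1(ii) p.7] -/
private theorem le_sup_zpowers_of_dense {I J : Subgroup Hstar} (hJ : IsOpen (J : Set Hstar))
    {g : I} (hg : Dense (Subgroup.zpowers g : Set I)) :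
    I ≤ J ⊔ Subgroup.zpowers (g : Hstar) := by
  intro x hx
  set K : Subgroup Hstar := J ⊔ Subgroup.zpowers (g : Hstar) with hK
  have hKo : IsOpen (K : Set Hstar) := Subgroup.isOpen_mono le_sup_left hJ
  have hKc : IsClosed (K : Set Hstar) := Subgroup.isClosed_of_isOpen _ hKo
  have hpre : IsClosed ((fun y : I => (y : Hstar)) ⁻¹' (K : Set Hstar)) :=
    hKc.preimage continuous_subtype_val
  have hsub : (Subgroup.zpowers g : Set I) ⊆ (fun y : I => (y : Hstar)) ⁻¹' (K : Set Hstar) := by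
    intro y hy
    obtain ⟨n, rfl⟩ := Subgroup.mem_zpowers_iff.mp hy
    show ((g ^ n : I) : Hstar) ∈ K
    rw [SubgroupClass.coe_zpow]
    exact Subgroup.mem_sup_right (Subgroup.zpow_mem _ (Subgroup.mem_zpowers _) n)
  have hall : (Set.univ : Set I) ⊆ (fun y : I => (y : Hstar)) ⁻¹' (K : Set Hstar) := by
    rw [← hg.closure_eq]
    exact hpre.closure_subset_iff.mpr hsub
  exact hall (Set.mem_univ (⟨x, hx⟩ : I))

end Helpers

variable [IsTopologicalGroup Hstar]
variable (G : PSCDatum Hstar)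

/-- "Totally ramified at some cusp" of the Lem 4.5 SUB-DAG for `J ⊆ I·J`, `J` characteristic open,
IS layer L3's `IsCuspidallyTotallyRamified (I ⊔ J) J` ([CombGC] Def. 1.4 (v)) — unconditionally (the
variant of abc-iut-w5-d062's `totallyRamifiedAtSomeCusp_ofPSC_iff` with neither the guard `J ≠ I·J`
nor a cusp-existence hypothesis).
[cite: MochizukiCombGC2007, Def 1.4(v) p.11] [cite: MochizukiAbsTopI2012, Lemma 4.5 (iv) p.54] -/
theorem CuspInertiaData.totallyRamifiedAtSomeCusp_ofPSC_iff' (I J : Subgroup Hstar)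
    (hJ : J.Characteristic) (hJo : IsOpen (J : Set Hstar)) :
    (CuspInertiaData.ofPSC G).TotallyRamifiedAtSomeCusp (I ⊔ J) J ↔
      G.IsCuspidallyTotallyRamified (I ⊔ J) J := by
  have hgal : PSCDatum.IsGaloisCovering (I ⊔ J) J := by
    refine ⟨le_sup_right, hJo, Subgroup.isOpen_mono le_sup_right hJo, ?_⟩
    haveI : J.Normal := inferInstance
    exact Subgroup.Normal.subgroupOf inferInstance _
  constructor
  · rintro ⟨I', hI', hram⟩
    rw [CuspInertiaData.mem_inertiaSet_ofPSC_iff] at hI'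
    obtain ⟨c, γ, rfl⟩ := hI'
    exact ⟨hgal, c, γ, by rwa [inf_comm] at hram⟩
  · rintro ⟨-, c, γ, hram⟩
    refine ⟨γ • G.cuspGp c, (CuspInertiaData.mem_inertiaSet_ofPSC_iff G _).2 ⟨c, γ, rfl⟩, ?_⟩
    rwa [inf_comm]

/-- **SUB-NODE B3 of the [AbsTopI] Lemma 4.5 SUB-DAG at `ofPSC G`, PROVED for every pro-`{l}` PSC
datum on a profinite `H_*`**: for a closed `I ≅ ℤ_l` and a characteristic open `J` with `J ≠ I·J`,
the cyclic covering `J ⊆ I·J` is totally ramified at some cusp iff `r(I^l·J) < l · r(I·J)` — the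
third sentence of Lemma 4.5 (iv) as AMENDED by [IUTchI] Rmk 1.2.2 (i)(ii) ("`[G : G'' → G]` …
cuspidally totally ramified if and only if `r(G″) < l · r(G)`", Rmk 1.2.3 (iii) p. 41), via layer
L3's relative cyclic criterion and the identification of the unique degree-`l` intermediate covering
with `I^l·J`. [cite: Mochizuki2012, IUTchI Rmk 1.2.3(iii) p.41]
[cite: MochizukiAbsTopI2012, Lemma 4.5 (iv) p.54] -/
theorem CuspInertiaData.totRamIffCount_ofPSC [CompactSpace Hstar] {l : ℕ} (hS : G.Sigma = {l}) :
    (CuspInertiaData.ofPSC G).TotRamIffCount l := by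
  intro I J _hIc hIcyc hJchar hJo hne
  have hl := G.prime_of_sigma_eq hS
  haveI : Fact l.Prime := ⟨hl⟩
  haveI : J.Characteristic := hJchar
  haveI hJn : J.Normal := inferInstance
  -- `J` and `B := I ⊔ J` are open of finite index
  haveI : Finite (Hstar ⧸ J) := Subgroup.quotient_finite_of_isOpen J hJo
  haveI hJfi : J.FiniteIndex := Subgroup.finiteIndex_of_finite_quotient
  set B : Subgroup Hstar := I ⊔ J with hB
  haveI hBfi : B.FiniteIndex := Subgroup.finiteIndex_of_le (le_sup_right : J ≤ B)
  -- a dense generator `a` of `I`: `B = J ⊔ ⟨a⟩`, so `J ⊆ B` is a cyclic covering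
  obtain ⟨g, hg⟩ := hIcyc.exists_dense_zpowers
  set a : Hstar := (g : Hstar) with ha
  have haI : a ∈ I := g.2
  have hgen : J ⊔ Subgroup.zpowers a = B :=
    le_antisymm (sup_le le_sup_right ((Subgroup.zpowers_le.mpr haI).trans le_sup_left))
      (sup_le (le_sup_zpowers_of_dense hJo hg) le_sup_left)
  have hBo : IsOpen (B : Set Hstar) := Subgroup.isOpen_mono le_sup_right hJo
  have hcyc : PSCDatum.IsCyclicCovering B J :=
    ⟨⟨le_sup_right, hJo, hBo, Subgroup.Normal.subgroupOf inferInstance _⟩,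
      a, Subgroup.mem_sup_left haI, hgen⟩
  -- the degree `[B : J] = l ^ k`, `k ≥ 1`
  obtain ⟨m, hm⟩ := G.index_eq_pow_of_sigma_eq hS hJo
  obtain ⟨k, -, hk⟩ := (Nat.dvd_prime_pow hl).mp
    (hm ▸ Subgroup.relIndex_dvd_index_of_le (le_sup_right : J ≤ B))
  have hkpos : 0 < k := by
    rcases Nat.eq_zero_or_pos k with rfl | h
    · exfalso
      apply hne
      rw [pow_zero, Subgroup.relIndex_eq_one] at hk
      exact le_antisymm le_sup_right hk
    · exact h
  -- layer L3's relative cyclic criterion for `G_J → G_B`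
  have hL3 := G.isCuspidallyTotallyRamified_iff_cuspCount_lt hS hkpos hcyc hk
  -- the Frattini subgroup `M` of the layer and its identification with `I^l·J`
  obtain ⟨M, hJM, hMB, hMne, hMidx, hfrat⟩ :=
    PSCCounting.exists_frattini_of_cyclic_quotient J B hgen hl hkpos hk
  set M₀ : Subgroup Hstar :=
    Subgroup.closure ((fun x : Hstar => x ^ l) '' (I : Set Hstar)) ⊔ J with hM₀
  have hM₀B : M₀ ≤ B := by
    refine sup_le ((Subgroup.closure_le _).mpr ?_) le_sup_right
    rintro _ ⟨x, hx, rfl⟩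
    exact Subgroup.mem_sup_left (I.pow_mem hx l)
  -- `I^l·J ⊆ M`: `l`-th powers of elements of `B` lie in the index-`l` normal subgroup `M`
  have hMn : (M.subgroupOf B).Normal := normal_subgroupOf_of_cyclic hgen hJM hMB
  have hM₀M : M₀ ≤ M := by
    refine sup_le ((Subgroup.closure_le _).mpr ?_) hJM
    rintro _ ⟨x, hx, rfl⟩
    have h := pow_relIndex_mem hMn (Subgroup.mem_sup_left hx : x ∈ B)
    rwa [hMidx] at h
  -- `M ⊆ I^l·J`: an element `j · a^n` of `M` has `l ∣ n` (else `a^n` generates `B` over `J`)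
  have hJnB : (J.subgroupOf B).Normal := Subgroup.Normal.subgroupOf inferInstance _
  have halk : a ^ l ^ k ∈ J := by
    have h := pow_relIndex_mem hJnB (Subgroup.mem_sup_left haI : a ∈ B)
    rwa [hk] at h
  have hMM₀ : M ≤ M₀ := by
    intro x hx
    have hxB : x ∈ B := hMB hx
    rw [← hgen, ← SetLike.mem_coe, Subgroup.normal_mul] at hxB
    obtain ⟨j, hj, w, hw, rfl⟩ := Set.mem_mul.mp hxB
    obtain ⟨n, rfl⟩ := Subgroup.mem_zpowers_iff.mp hw
    -- `a ^ n ∈ M`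
    have han : a ^ n ∈ M := by
      have : j⁻¹ * (j * a ^ n) ∈ M := M.mul_mem (M.inv_mem (hJM hj)) hx
      rwa [inv_mul_cancel_left] at this
    -- hence `l ∣ n`
    have hdvd : (l : ℤ) ∣ n := by
      by_contra hnd
      have hcop1 : IsCoprime (n : ℤ) (l : ℤ) := by
        rw [Int.isCoprime_iff_gcd_eq_one, Int.gcd_eq_natAbs, Int.natAbs_natCast]
        exact Nat.coprime_comm.mp (hl.coprime_iff_not_dvd.mpr fun h => hnd (Int.natCast_dvd.mpr h))
      obtain ⟨u, v, huv⟩ := (hcop1.pow_right : IsCoprime (n : ℤ) ((l : ℤ) ^ k))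
      -- `a = (a^n)^u * (a^(l^k))^v ∈ M`, so `B = J ⊔ ⟨a⟩ ≤ M`: contradiction
      have haM : a ∈ M := by
        have h1 : a = (a ^ n) ^ u * (a ^ l ^ k) ^ v := by
          conv_lhs => rw [← zpow_one a, ← huv]
          rw [zpow_add, mul_comm u n, zpow_mul, mul_comm v, zpow_mul, ← Nat.cast_pow, zpow_natCast]
        rw [h1]
        exact M.mul_mem (M.zpow_mem han u) (M.zpow_mem (hJM halk) v)
      apply hMne
      refine le_antisymm hMB ?_
      rw [← hgen]
      exact sup_le hJM (Subgroup.zpowers_le.mpr haM)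
    obtain ⟨t, rfl⟩ := hdvd
    have hpow : a ^ ((l : ℤ) * t) ∈ Subgroup.closure ((fun x : Hstar => x ^ l) '' (I : Set Hstar)) := by
      rw [zpow_mul, zpow_natCast]
      exact Subgroup.zpow_mem _ (Subgroup.subset_closure (Set.mem_image_of_mem (fun x : Hstar => x ^ l) haI)) t
    have hmem : j * a ^ ((l : ℤ) * t) ∈ J ⊔ Subgroup.closure ((fun x : Hstar => x ^ l) '' (I : Set Hstar)) :=
      Subgroup.mul_mem_sup hj hpow
    rwa [sup_comm] at hmem
  have hMeq : M = M₀ := le_antisymm hMM₀ hM₀M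
  -- assemble: bridge ↔ L3's criterion ↔ the single inequality at the unique index-`l` subgroup
  rw [CuspInertiaData.totallyRamifiedAtSomeCusp_ofPSC_iff' G I J hJchar hJo, hL3]
  simp only [CuspInertiaData.ofPSC_r]
  constructor
  · intro h
    rw [← hMeq]
    exact h M hJM hMB hMidx
  · intro hlt M' hJM' hM'B hM'idx
    -- uniqueness of the index-`l` intermediate subgroup
    have hM'M : M' ≤ M := by
      by_contra h
      have hgen' := (hfrat M' hM'B).mpr h
      rw [sup_eq_right.mpr hJM'] at hgen'
      rw [hgen', Subgroup.relIndex_self] at hM'idx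
      exact hl.one_lt.ne hM'idx
    have hrel := Subgroup.relIndex_mul_relIndex M' M B hM'M hMB
    rw [hM'idx, hMidx] at hrel
    have h1 : M'.relIndex M = 1 := by
      have : M'.relIndex M * l = 1 * l := by rw [one_mul]; exact hrel
      exact Nat.eq_of_mul_eq_mul_right hl.pos this
    have hM'eq : M' = M := le_antisymm hM'M (Subgroup.relIndex_eq_one.mp h1)
    rw [hM'eq, hMeq]
    exact hlt

end Literature.AnabelianGeometry.AbsoluteAnabelian.FundamentalExtension

end
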